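import Literature.NumberTheory.Sieve.GoldbachLinnikShiftUniformity

/-!
# Tolerance of the `K = 7` criterion in the pair-sieve constant, with Pintz–Ruzsa's own inputs (Pintz–Ruzsa I/II;
Johnston–Trudgian 2026, Table 1)

Topic `Literature/NumberTheory/Sieve`.  **THIS IS NOT A ROUTE TO GOLDBACH, and `K = 7` is NOT claimed.**
Companion to `GoldbachLinnikShiftUniformity` for the reproduction cell `pub-lg7`.  That file re-based the cell's two
`K = 7` frames on the pair-sieve hypothesis `PairSieveBound a c` ((†): `#{p, p' ≤ N : p' − p = h} ≤
(c + η)𝔖(|h|)N/log²N` for `0 < |h| ≤ N^a`, eventually) at the cell's OWN constants (flat `C* ≤ 3.44` with the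
Maynard–Pandey–Radziwiłł `λ`; graded mean `≤ 3.32451` with Pintz–Ruzsa's `λ`).  This file records the TOLERANCE of
the criterion with Pintz–Ruzsa's own large-deviation constant `λ = 0.789401` and their major arcs of level `N^θ`,
`θ ≥ 4/9 − 10⁻⁴` — i.e. how large a pair-sieve constant, uniform in the shift, the printed architecture absorbs:

* `goldbach_linnik_seven_of_graded_pairSieve_inputs_tol`: ANY graded profile `(a_i, c_i)` of mean
  `C̄ = Σ c_i (a_i² − a_{i−1}²) ≤ 3.376` whose layers (†) hold gives `K = 7` (with `R₀ = 1.94`, `C₀ ≤ 0.6601618373`,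
  `A(3) ≤ 0.0136`, `A(4) ≤ 0.004`, the summed / pointwise major-arc bounds and the large-deviation set as
  hypotheses).  The cell's tabulated profile has `C̄ = 3.3245094…` (its two certified engines give `≤ 3.3189`), so the
  kernel now carries the margin `0.05` in `C̄` that the cell's `numbers.tex` calls `CBARSLACK` — as a statement about
  a HYPOTHETICAL profile; no profile value is asserted.
* `goldbach_linnik_seven_of_flat_pairSieve_inputs_PR`: in particular a FLAT constant, uniform over all shifts
  `0 < |h| ≤ N`, of size `C* ≤ 3.376` (`C₁ = 2C* ≤ 6.752` in Johnston–Trudgian's normalisation) gives `K = 7`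
  with no input from Maynard–Pandey–Radziwiłł.  This is the kernel form of the `K = 7`, no-GRH entry of
  Johnston–Trudgian's Table 1 ("`C₁` required: `6.737`", computed there with a decimal for `R₀` that the cell
  contradicts; with `R₀ < 1.94` the sufficient value is `6.752`, cf. `crit43_lt_one_of_Cstar_le`), and the precise
  meaning of the cell's re-charge "certify `C₁ ≤ 6.737` uniformly in the shift": NO such constant is in print —
  Chen's `3.9171` (`C₁ = 7.83`) and Lichtman's preprint `3.3907` (`C₁ = 6.78`) both lie outside
  (`crit43_not_lt_one_of_flat_Lichtman`: `C* < 3.385` is necessary on the fine box).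

## References

* J. Pintz, I. Z. Ruzsa, *On Linnik's approximation to Goldbach's problem, I*, Acta Arith. 109 (2003) 169–194:
  §10 (10.10)–(10.16), Lemma 13, Theorem 4 (9.10), (8.14), Corollary 2. [PintzRuzsa2003]
* J. Pintz, I. Z. Ruzsa, *On Linnik's approximation to Goldbach's problem. II*, Acta Math. Hungar. 161 (2020)
  569–582: Lemma 5, (4.2)–(4.8). [PintzRuzsa2020]
* D. R. Johnston, T. Trudgian, *An update on the Linnik–Goldbach and Romanov problems*, arXiv:2605.17825v2
  (2026): Table 1 (`K = 7`, no GRH), Prop. 2.2, (C2def1). PREPRINT. [JohnstonTrudgian2026]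
-/

noncomputable section

open scoped FourierTransform

open Finset Filter MeasureTheory

namespace Literature.NumberTheory.Sieve

namespace GoldbachLinnik

/-- **`K = 7` from ANY graded pair-sieve profile of mean `≤ 3.376`, with Pintz–Ruzsa's own inputs.**
Hypotheses — every one of them; nothing is asserted: a step profile `0 = a₀ ≤ ⋯ ≤ a_m = 1`, `c_i ≥ 1`, of mean
`profileMean m a c ≤ 3.376` whose layers `PairSieveBound (a_i) (c_i)` hold; the Romanov bound with `R₀ = 1.94`
(Pintz–Ruzsa I (8.14)); `C₀ ≤ 0.6601618373`; Pintz–Ruzsa's periodised major arcs at level `N^θ`,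
`4/9 − 10⁻⁴ ≤ θ ≤ 1`, with the summed major-arc lower bound `hmaj` (Pintz–Ruzsa II (4.5) shape) and the pointwise
upper bound `hM`; `0 ≤ A(3) ≤ 0.0136`, `0 ≤ A(4) ≤ 0.004` (Pintz–Ruzsa I, Theorem 4); the large-deviation set of
measure `≤ C_E N^{-3/5} L^{-100}` off which `|G| ≤ λL`, `λ ≤ 0.789401` (Corollary 2).  Proof:
`minorArc_meanSquare_le_of_pairSieveProfile_periodicArcs` gives `hCi` with
`C = C₀R₀(C̄ − 1) + (log 2/2)(1 − θ) ≤ C₀R₀(C̄ − 1) + (log 2/2)(5/9 + 10⁻⁴)`, and `crit43_lt_one_of_Cstar_le`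
(with `C*` read as `C̄`) the `(4, 3)` criterion. [cite: PintzRuzsa2003, §10 (10.10)–(10.16), Lemma 13, Corollary 2] -/
theorem goldbach_linnik_seven_of_graded_pairSieve_inputs_tol
    {P Q : ℕ → ℝ} {θ : ℝ} (hθ0 : 4 / 9 - 1 / 10 ^ 4 ≤ θ) (hθ1 : θ ≤ 1)
    (hP : ∀ᶠ N : ℕ in atTop, (N : ℝ) ^ θ ≤ P N) (hPQ : ∀ᶠ N : ℕ in atTop, P N + 1 ≤ Q N)
    (hQ1 : ∀ᶠ N : ℕ in atTop, (N : ℝ) ^ θ ≤ Q N) (hQ2 : ∀ᶠ N : ℕ in atTop, Q N ≤ (N : ℝ) ^ (1 - θ))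
    {E : ℕ → Set ℝ} (hE : ∀ N, MeasurableSet (E N))
    {m : ℕ} {a c : ℕ → ℝ} (ha0 : a 0 = 0) (ham : a m = 1) (ha : Monotone a)
    (hc : ∀ i, 1 ≤ c i) (hCbar : profileMean m a c ≤ 3.376)
    {A₃ A₄ lam Cerr CE : ℝ} (hA3le : A₃ ≤ 0.0136) (hA3nn : 0 ≤ A₃) (hA4le : A₄ ≤ 0.004)
    (hA4nn : 0 ≤ A₄) (hlamle : lam ≤ 0.789401) (hlamnn : 0 ≤ lam)
    (hC₀ : twinPrimeConst ≤ 0.6601618373)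
    (hR : ∀ J : ℕ, ∑ j ∈ Icc 1 J, oddSingularFactor (2 ^ j - 1) ≤ 1.94 * J)
    (hprof : ∀ i ∈ Icc 1 m, PairSieveBound (a i) (c i))
    (hmaj : ∀ ε : ℝ, 0 < ε → ∀ᶠ N : ℕ in atTop,
      (1 - ε) * (N / Real.log N ^ 2) *
          (∑ z ∈ offDiagExpPairs N, goldbachSingularSeries (pairShift z).natAbs) -
        ε * (N * (powLen N : ℝ) ^ 2 / Real.log N ^ 2) ≤
        ∑ z ∈ offDiagExpPairs N, majorArcPairIntegral (periodicArcs (P N) (Q N)) N (pairShift z))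
    (hM : ∀ᶠ N : ℕ in atTop, ∀ m : ℤ, m ≠ 0 → Even m →
      majorArcPairIntegral (periodicArcs (P N) (Q N)) N m ≤
        goldbachSingularSeries m.natAbs * N / Real.log N ^ 2 + Cerr * N / Real.log N ^ 3)
    (hA4 : ∀ ε : ℝ, 0 < ε → ∀ᶠ N : ℕ in atTop,
      pairSingularSum N 4 ≤ (1 + A₄ + ε) * (2 * (powLen N : ℝ) ^ (2 * 4)))
    (hA3 : ∀ ε : ℝ, 0 < ε → ∀ᶠ N : ℕ in atTop,
      pairSingularSum N 3 ≤ (1 + A₃ + ε) * (2 * (powLen N : ℝ) ^ (2 * 3)))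
    (hEvol : ∀ᶠ N : ℕ in atTop,
      (volume (E N ∩ Set.Icc (0 : ℝ) 1)).toReal ≤
        CE * (N : ℝ) ^ (-(3 / 5 : ℝ)) / (powLen N : ℝ) ^ 100)
    (hG : ∀ᶠ N : ℕ in atTop, ∀ α ∈ Set.Icc (0 : ℝ) 1 \ E N, ‖powSum N α‖ ≤ lam * powLen N) :
    goldbach_linnik_with 7 := by
  have hθpos : 0 < θ := by linarith
  have hCi := minorArc_meanSquare_le_of_pairSieveProfile_periodicArcs hθpos hθ1 hP hQ1 hQ2 ha0 ham ha
    hc (C₀ := 0.6601618373) (R₀ := 1.94) hC₀ hR hprof hmaj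
  have hpm : 0 ≤ profileMean m a c - 1 := profileMean_sub_one_nonneg ha0 ham ha hc
  have hlog : 0 < Real.log 2 := Real.log_pos (by norm_num)
  have h1θ : 0 ≤ 1 - θ := by linarith
  have hCnn : (0 : ℝ) ≤ 0.6601618373 * 1.94 * (profileMean m a c - 1) + Real.log 2 / 2 * (1 - θ) := by
    positivity
  have hCle : 0.6601618373 * 1.94 * (profileMean m a c - 1) + Real.log 2 / 2 * (1 - θ) ≤
      0.6601618373 * 1.94 * (profileMean m a c - 1) + Real.log 2 / 2 * (5 / 9 + 1 / 10 ^ 4) := by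
    have h59 : 1 - θ ≤ 5 / 9 + 1 / 10 ^ 4 := by linarith
    nlinarith
  have hP' : ∀ᶠ N : ℕ in atTop, (N : ℝ) ^ (2 / 5 : ℝ) ≤ P N := by
    filter_upwards [hP, eventually_ge_atTop 1] with N hN hN1
    have hN1' : (1 : ℝ) ≤ N := by exact_mod_cast hN1
    exact (Real.rpow_le_rpow_of_exponent_le hN1' (by linarith)).trans hN
  have hQ' : ∀ᶠ N : ℕ in atTop, Q N ≤ (N : ℝ) ^ (3 / 5 : ℝ) := by
    filter_upwards [hQ2, eventually_ge_atTop 1] with N hN hN1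
    have hN1' : (1 : ℝ) ≤ N := by exact_mod_cast hN1
    exact hN.trans (Real.rpow_le_rpow_of_exponent_le hN1' (by linarith))
  exact goldbach_linnik_with_of_PintzRuzsa_inputs (i := 4) (j := 3) (by norm_num) (by norm_num) hE hP' hPQ
    hQ' hA4nn hA3nn hCnn hlamnn
    (crit43_lt_one_of_Cstar_le (C0R0 := 0.6601618373 * 1.94) hA3le hA3nn hA4le hA4nn (by norm_num)
      (by norm_num) hCbar hCle hCnn hlamle hlamnn)
    hM hA4 hA3 hEvol hG hCi

/-- **A uniform flat pair-sieve constant `C* ≤ 3.376` (`C₁ ≤ 6.752`) would give `K = 7` with Pintz–Ruzsa's own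
inputs** — the kernel form of the `K = 7`, no-GRH threshold of Johnston–Trudgian's Table 1.  Hypotheses — every
one of them; nothing is asserted: (†) for ALL shifts `0 < |h| ≤ N` with a constant `1 ≤ C* ≤ 3.376` (NOT in
print: Chen's `3.9171` and Lichtman's preprint `3.3907` are larger); otherwise as in
`goldbach_linnik_seven_of_graded_pairSieve_inputs_tol`, of which this is the one-layer case `a = (0, 1)`,
`c ≡ C*` (`C̄ = C*`). [cite: JohnstonTrudgian2026, Table PRtable (K = 7, no GRH)] -/
theorem goldbach_linnik_seven_of_flat_pairSieve_inputs_PR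
    {P Q : ℕ → ℝ} {θ : ℝ} (hθ0 : 4 / 9 - 1 / 10 ^ 4 ≤ θ) (hθ1 : θ ≤ 1)
    (hP : ∀ᶠ N : ℕ in atTop, (N : ℝ) ^ θ ≤ P N) (hPQ : ∀ᶠ N : ℕ in atTop, P N + 1 ≤ Q N)
    (hQ1 : ∀ᶠ N : ℕ in atTop, (N : ℝ) ^ θ ≤ Q N) (hQ2 : ∀ᶠ N : ℕ in atTop, Q N ≤ (N : ℝ) ^ (1 - θ))
    {E : ℕ → Set ℝ} (hE : ∀ N, MeasurableSet (E N))
    {A₃ A₄ Cst lam Cerr CE : ℝ} (hA3le : A₃ ≤ 0.0136) (hA3nn : 0 ≤ A₃) (hA4le : A₄ ≤ 0.004)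
    (hA4nn : 0 ≤ A₄) (hCst1 : 1 ≤ Cst) (hCst : Cst ≤ 3.376) (hlamle : lam ≤ 0.789401)
    (hlamnn : 0 ≤ lam) (hC₀ : twinPrimeConst ≤ 0.6601618373)
    (hR : ∀ J : ℕ, ∑ j ∈ Icc 1 J, oddSingularFactor (2 ^ j - 1) ≤ 1.94 * J)
    (hflat : PairSieveBound 1 Cst)
    (hmaj : ∀ ε : ℝ, 0 < ε → ∀ᶠ N : ℕ in atTop,
      (1 - ε) * (N / Real.log N ^ 2) *
          (∑ z ∈ offDiagExpPairs N, goldbachSingularSeries (pairShift z).natAbs) -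
        ε * (N * (powLen N : ℝ) ^ 2 / Real.log N ^ 2) ≤
        ∑ z ∈ offDiagExpPairs N, majorArcPairIntegral (periodicArcs (P N) (Q N)) N (pairShift z))
    (hM : ∀ᶠ N : ℕ in atTop, ∀ m : ℤ, m ≠ 0 → Even m →
      majorArcPairIntegral (periodicArcs (P N) (Q N)) N m ≤
        goldbachSingularSeries m.natAbs * N / Real.log N ^ 2 + Cerr * N / Real.log N ^ 3)
    (hA4 : ∀ ε : ℝ, 0 < ε → ∀ᶠ N : ℕ in atTop,
      pairSingularSum N 4 ≤ (1 + A₄ + ε) * (2 * (powLen N : ℝ) ^ (2 * 4)))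
    (hA3 : ∀ ε : ℝ, 0 < ε → ∀ᶠ N : ℕ in atTop,
      pairSingularSum N 3 ≤ (1 + A₃ + ε) * (2 * (powLen N : ℝ) ^ (2 * 3)))
    (hEvol : ∀ᶠ N : ℕ in atTop,
      (volume (E N ∩ Set.Icc (0 : ℝ) 1)).toReal ≤
        CE * (N : ℝ) ^ (-(3 / 5 : ℝ)) / (powLen N : ℝ) ^ 100)
    (hG : ∀ᶠ N : ℕ in atTop, ∀ α ∈ Set.Icc (0 : ℝ) 1 \ E N, ‖powSum N α‖ ≤ lam * powLen N) :
    goldbach_linnik_with 7 := by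
  -- the one-layer profile `a = (0, 1)`, `c ≡ C*`, of mean `C*`
  have ha : Monotone fun i : ℕ => ((min i 1 : ℕ) : ℝ) := fun i j hij => by
    show ((min i 1 : ℕ) : ℝ) ≤ ((min j 1 : ℕ) : ℝ)
    exact_mod_cast min_le_min_right 1 hij
  have hprof : ∀ i ∈ Icc 1 1, PairSieveBound ((fun i : ℕ => ((min i 1 : ℕ) : ℝ)) i) ((fun _ : ℕ => Cst) i) := by
    intro i hi
    obtain ⟨h1, h2⟩ := Finset.mem_Icc.mp hi
    obtain rfl : i = 1 := le_antisymm h2 h1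
    simpa using hflat
  have hCbar : profileMean 1 (fun i : ℕ => ((min i 1 : ℕ) : ℝ)) (fun _ => Cst) ≤ 3.376 := by
    simp [profileMean]
    exact hCst
  exact goldbach_linnik_seven_of_graded_pairSieve_inputs_tol hθ0 hθ1 hP hPQ hQ1 hQ2 hE
    (m := 1) (a := fun i : ℕ => ((min i 1 : ℕ) : ℝ)) (c := fun _ => Cst) (by simp) (by simp) ha
    (fun _ => hCst1) hCbar hA3le hA3nn hA4le hA4nn hlamle hlamnn hC₀ hR hprof hmaj hM hA4 hA3 hEvol hG

end GoldbachLinnik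

end Literature.NumberTheory.Sieve
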